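import Summits.QuantumFields.YangMills.Theorems.AllWindowsColdBoxDirFreeVarChains
import HarnessLib

/-!
# Stub C `DirFreeVarLinear` (stmt-QuantumFields-24003) — part 4: every free Dirichlet edge variable has variance `≤ 16·H`

Stub C of LINE-17 «hypercontractive second-order tilt expansion» (`DirFreeVarLinear`, crux `AllWindowsColdBox.BoxMidWindowsSU22`,
stmt-QuantumFields-24003; also the C-component of the shared obligation S2 of LINE-18 on stmt-QuantumFields-24006) — part 4, BY NAME:
**the perimeter law of the free forest-gauge field** — every free edge variable of the temporal-gauge Dirichlet lattice-Maxwell Gaussian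
`boxDirichlet H` of the cold-wall box has variance `E_D[s_e²] = (Q_D⁻¹)_{ee} ≤ 16·H` (`H ≥ 1`), uniformly over the three edge classes:
* `box_of_mem`, `face_of_free_temporal`, `update_eq_update_iff` — bookkeeping;
* `inv_diag_le` — the case analysis: temporal edges over a face point / spatial edges on the bottom face or with a transverse face coordinate
  (one collar plaquette, `≤ 1`), spatial edges at height `≥ 1` with interior transverse coordinates (temporal column, doubled through the
  face `x_i ∈ {0,2H}` when needed, `≤ 2(2H+1)`), bottom temporal edges over spatially interior points (Pólya octant flow × time,
  `≤ 4(2H+2)`) — all `≤ 16H`;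
* `DirFreeVarLinear` (the registered Prop, verbatim) and `stub_dirFreeVarLinear : DirFreeVarLinear` with `c = 16`.
Route: Thomson's principle with explicit 2-chains (parts 1–3); the linear (not `H log H`) rate of the «Polyakov» class is the bounded
energy of a point-to-wall unit flow in `ℤ³`.  Instrument I17 of planner ym-idea-2 measured `max_e C_ee ≈ 0.54–0.78·H` (`H ≤ 12`).

HONEST LABEL: one registered M–L stub of two critic-PASSed lines on the R2ξ″ RECORD-rung cruxes 24003/24006; no crux, rung or summit is
proved; the Yang–Mills mass gap is NOT proved by this file.
-/

set_option autoImplicit false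

noncomputable section

open MeasureTheory Matrix Finset
open Literature.MathematicalPhysics.QuantumFieldTheory
open Literature.MathematicalPhysics.QuantumFieldTheory.LatticeMaxwell
open Literature.MathematicalPhysics.QuantumFieldTheory.AxialGauge
open Literature.Probability.LatticeModels (Site halfOpenBox mem_halfOpenBox)
open Summit.QuantumFields.YangMills.Theorems.WeakCouplingRates

namespace Summit.QuantumFields.YangMills.Theorems.AllWindowsColdBoxDirFreeVar

section Assembly

variable {H : ℕ}

/-! ### Assembly: every free edge -/

/-- Box coordinates of an edge of `dirFreeEdges H`. -/
theorem box_of_mem {x : Site 4} {i : Fin 4} (h : (x, i) ∈ dirFreeEdges H) :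
    (∀ k : Fin 4, 0 ≤ x k ∧ x k ≤ 2 * (H : ℤ)) ∧ x i + 1 ≤ 2 * (H : ℤ) := by
  have hb := (mem_dirFreeEdges.1 h).1
  rw [mem_boxEdges_iff] at hb
  push_cast at hb
  exact ⟨fun k => by have := hb.1 k; omega, by have := hb.2; omega⟩

/-- A free temporal edge at height `≥ 1` has a transverse coordinate on a face. -/
theorem face_of_free_temporal {w : Site 4} (hf : (w, (0 : Fin 4)) ∈ dirFreeEdges H) (hw0 : 1 ≤ w 0) :
    ∃ k : Fin 4, k ≠ 0 ∧ (w k = 0 ∨ w k = 2 * (H : ℤ)) := by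
  have hb := box_of_mem hf
  have hnf := (mem_dirFreeEdges.1 hf).2
  by_contra hne
  push Not at hne
  apply hnf
  refine ⟨rfl, fun k => ?_⟩
  show 1 ≤ w k ∧ w k + 1 ≤ 2 * (H : ℤ)
  by_cases hk : k = 0
  · subst hk; have := hb.2; omega
  · have := hne k hk; have := hb.1 k; omega

/-- Spatial projections agree iff the spatial coordinates do. -/
theorem update_eq_update_iff (w z : Site 4) :
    Function.update w 0 0 = Function.update z 0 0 ↔ ∀ j : Fin 4, j ≠ 0 → w j = z j := by
  constructor
  · intro h j hj
    have := congrFun h j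
    simpa [Function.update_of_ne hj] using this
  · intro h
    funext j
    by_cases hj : j = 0
    · subst hj; simp
    · simp [hj, h j hj]

/-- **Every free edge variable of the Dirichlet problem has variance at most `16 H`**: `(Q_D⁻¹)_{ee} ≤ 16H` (`H ≥ 1`). -/
theorem inv_diag_le (hH : 1 ≤ H) (e : DirFree H) :
    (Qmat (fun e => e ∉ dirFreeEdges H) dirCorner (2 * H + 3))⁻¹ e e ≤ 16 * (H : ℝ) := by
  classical
  have hbox := free_box e
  have hnf := free_not_forest e
  have hHz : (1 : ℤ) ≤ H := by exact_mod_cast hH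
  have hHr : (1 : ℝ) ≤ H := by exact_mod_cast hH
  have b1 : (1 : ℝ) ≤ 16 * H := by linarith
  have b2 : 2 * (2 * (H : ℝ) + 1) ≤ 16 * H := by linarith
  have b3 : 4 * (2 * (H : ℝ) + 2) ≤ 16 * H := by linarith
  obtain ⟨⟨⟨z, i⟩, hmem⟩, hfree⟩ := e
  simp only at hbox hnf
  by_cases hi : i = 0
  · subst hi
    by_cases hface : ∃ j : Fin 4, j ≠ 0 ∧ (z j = 0 ∨ z j = 2 * (H : ℤ))
    · obtain ⟨j, hj, hzj | hzj⟩ := hface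
      · -- face `z_j = 0`: the collar plaquette `(z − e_j, 0, j)` (third edge `= e`)
        refine (inv_diag_le_one_of_plaquette _ (z - Pi.single j 1, 0, j) ?_ (-1) (by norm_num) fun e' =>
          coeffAux_slot3 (z - Pi.single j 1, 0, j) _ (by simp) ?_ ?_ ?_ e').trans b1
        · refine shift_mem_index (Fin.pos_iff_ne_zero.2 hj) fun l => ?_
          have := hbox.1 l; have := hbox.2
          by_cases hl0 : l = 0
          · subst hl0; simp [hj.symm]; omega
          · by_cases hlj : l = j
            · subst hlj; simp [hl0]; omega
            · simp [hl0, hlj, Pi.sub_apply]; omega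
        · exact not_free_of_fst ⟨j, Or.inl (by simp [hzj])⟩
        · exact not_free_of_fst ⟨j, Or.inl (by simp [hzj, hj])⟩
        · exact not_free_of_fst ⟨j, Or.inl (by simp [hzj])⟩
      · -- face `z_j = 2H`: the collar plaquette `(z, 0, j)` (first edge `= e`)
        refine (inv_diag_le_one_of_plaquette _ (z, 0, j) ?_ 1 (by norm_num) fun e' =>
          coeffAux_slot1 (z, 0, j) _ rfl ?_ ?_ ?_ e').trans b1
        · refine shift_mem_index (Fin.pos_iff_ne_zero.2 hj) fun l => ?_
          have := hbox.1 l; have := hbox.2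
          by_cases hl0 : l = 0
          · subst hl0; simp [hj.symm]; omega
          · by_cases hlj : l = j
            · subst hlj; simp [hl0]; omega
            · simp [hl0, hlj]; omega
        · exact not_free_of_snd ⟨j, Or.inr (by simp [hzj, hj])⟩
        · exact not_free_of_fst ⟨j, Or.inr (by simp [hzj])⟩
        · exact not_free_of_snd ⟨j, Or.inr (by simp [hzj])⟩
    · -- spatially interior base: the bottom «Polyakov» edge, octant flow
      push Not at hface
      have hint : ∀ j : Fin 4, j ≠ 0 → 1 ≤ z j ∧ z j + 1 ≤ 2 * (H : ℤ) := fun j hj => by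
        have := hface j hj; have := hbox.1 j; omega
      have hz0 : z 0 = 0 := by
        by_contra hne; apply hnf; refine ⟨rfl, fun k => ?_⟩
        by_cases hk : k = 0
        · subst hk; have := hbox.1 0; have := hbox.2; omega
        · exact hint k hk
      exact (inv_diag_le_of_flow _ rfl hz0 hint).trans b3
  · -- spatial edge `(z, i)`, `i ≠ 0`
    by_cases ht0 : z 0 = 0
    · -- bottom face: the collar plaquette `(z − e₀, 0, i)` (second edge `= e`)
      refine (inv_diag_le_one_of_plaquette _ (z - Pi.single 0 1, 0, i) ?_ 1 (by norm_num) fun e' =>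
        coeffAux_slot2 (z - Pi.single 0 1, 0, i) _ (by simp) ?_ ?_ ?_ e').trans b1
      · refine shift_mem_index (Fin.pos_iff_ne_zero.2 hi) fun l => ?_
        have := hbox.1 l; have := hbox.2
        by_cases hl0 : l = 0
        · subst hl0; simp [Ne.symm hi]; omega
        · by_cases hli : l = i
          · subst hli; simp [hl0]; omega
          · simp [hl0, hli]; omega
      · exact not_free_of_fst ⟨0, Or.inl (by simp [ht0])⟩
      · exact not_free_of_fst ⟨0, Or.inl (by simp [ht0, hi])⟩
      · exact not_free_of_fst ⟨0, Or.inl (by simp [ht0])⟩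
    · have ht1 : 1 ≤ z 0 := by have := hbox.1 0; omega
      by_cases hface : ∃ j : Fin 4, j ≠ 0 ∧ j ≠ i ∧ (z j = 0 ∨ z j = 2 * (H : ℤ))
      · obtain ⟨j, hj0, hji, hzj | hzj⟩ := hface
        · -- transverse face `z_j = 0`
          rcases lt_or_gt_of_ne hji with hlt | hlt
          · -- `j < i`: collar plaquette `(z − e_j, j, i)`, second edge `= e`
            refine (inv_diag_le_one_of_plaquette _ (z - Pi.single j 1, j, i) ?_ 1 (by norm_num) fun e' =>
              coeffAux_slot2 (z - Pi.single j 1, j, i) _ (by simp) ?_ ?_ ?_ e').trans b1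
            · refine shift_mem_index hlt fun l => ?_
              have := hbox.1 l; have := hbox.2
              by_cases hlj : l = j
              · subst hlj; simp [hji]; omega
              · by_cases hli : l = i
                · subst hli; simp [hlj]; omega
                · simp [hlj, hli]; omega
            · exact not_free_of_fst ⟨j, Or.inl (by simp [hzj])⟩
            · exact not_free_of_fst ⟨j, Or.inl (by simp [hzj, hji.symm])⟩
            · exact not_free_of_fst ⟨j, Or.inl (by simp [hzj])⟩
          · -- `i < j`: collar plaquette `(z − e_j, i, j)`, third edge `= e`
            refine (inv_diag_le_one_of_plaquette _ (z - Pi.single j 1, i, j) ?_ (-1) (by norm_num) fun e' =>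
              coeffAux_slot3 (z - Pi.single j 1, i, j) _ (by simp) ?_ ?_ ?_ e').trans b1
            · refine shift_mem_index hlt fun l => ?_
              have := hbox.1 l; have := hbox.2
              by_cases hlj : l = j
              · subst hlj; simp [hji]; omega
              · by_cases hli : l = i
                · subst hli; simp [hlj]; omega
                · simp [hlj, hli]; omega
            · exact not_free_of_fst ⟨j, Or.inl (by simp [hzj])⟩
            · exact not_free_of_fst ⟨j, Or.inl (by simp [hzj, hji.symm])⟩
            · exact not_free_of_fst ⟨j, Or.inl (by simp [hzj])⟩
        · -- transverse face `z_j = 2H`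
          rcases lt_or_gt_of_ne hji with hlt | hlt
          · -- `j < i`: collar plaquette `(z, j, i)`, fourth edge `= e`
            refine (inv_diag_le_one_of_plaquette _ (z, j, i) ?_ (-1) (by norm_num) fun e' =>
              coeffAux_slot4 (z, j, i) _ rfl ?_ ?_ ?_ e').trans b1
            · refine shift_mem_index hlt fun l => ?_
              have := hbox.1 l; have := hbox.2
              by_cases hlj : l = j
              · subst hlj; simp [hji]; omega
              · by_cases hli : l = i
                · subst hli; simp [hlj]; omega
                · simp [hlj, hli]; omega
            · exact not_free_of_snd ⟨j, Or.inr (by simp [hzj])⟩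
            · exact not_free_of_fst ⟨j, Or.inr (by simp [hzj])⟩
            · exact not_free_of_snd ⟨j, Or.inr (by simp [hzj, hji.symm])⟩
          · -- `i < j`: collar plaquette `(z, i, j)`, first edge `= e`
            refine (inv_diag_le_one_of_plaquette _ (z, i, j) ?_ 1 (by norm_num) fun e' =>
              coeffAux_slot1 (z, i, j) _ rfl ?_ ?_ ?_ e').trans b1
            · refine shift_mem_index hlt fun l => ?_
              have := hbox.1 l; have := hbox.2
              by_cases hlj : l = j
              · subst hlj; simp [hji]; omega
              · by_cases hli : l = i
                · subst hli; simp [hlj]; omega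
                · simp [hlj, hli]; omega
            · exact not_free_of_snd ⟨j, Or.inr (by simp [hzj, hji.symm])⟩
            · exact not_free_of_fst ⟨j, Or.inr (by simp [hzj])⟩
            · exact not_free_of_snd ⟨j, Or.inr (by simp [hzj])⟩
      · -- transversely interior: temporal column(s)
        push Not at hface
        have hint : ∀ j : Fin 4, j ≠ 0 → j ≠ i → 1 ≤ z j ∧ z j ≤ 2 * (H : ℤ) - 1 := fun j hj0 hji => by
          have := hface j hj0 hji; have := hbox.1 j; omega
        have hzi := hbox.2
        have hzi0 := hbox.1 i
        -- the generic contradiction: a point with the spatial coordinates of `z` except `z_i ↦ v`, `1 ≤ v ≤ 2H − 1`,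
        -- carries no free temporal edge at height `≥ 1`
        have key : ∀ (w : Site 4) (v : ℤ), 1 ≤ v → v ≤ 2 * (H : ℤ) - 1 →
            (∀ j : Fin 4, j ≠ 0 → w j = if j = i then v else z j) →
            (w, (0 : Fin 4)) ∈ dirFreeEdges H → 1 ≤ w 0 → False := by
          intro w v hv1 hv2 hw hf hw0
          obtain ⟨k, hk0, hk⟩ := face_of_free_temporal hf hw0
          have := hw k hk0
          by_cases hki : k = i
          · subst hki; simp at this; omega
          · rw [if_neg hki] at this; have := hint k hk0 hki; omega
        by_cases hzi0' : z i = 0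
        · -- column doubled through the face `x_i = 0`: `y₂ = z − e_i`
          refine (inv_diag_le_of_column _ i hi rfl (z 0) rfl ht1 (z - Pi.single i 1) ?_ ?_ ?_).trans b2
          · intro j hj
            have := hbox.1 j
            by_cases hji : j = i
            · subst hji; simp; omega
            · simp [hji]; omega
          · intro w hf hw0
            simp only
            have hwb := box_of_mem hf
            rw [update_eq_update_iff, update_eq_update_iff, update_eq_update_iff, update_eq_update_iff]
            have hA : ¬ (∀ j : Fin 4, j ≠ 0 → w j = (z - Pi.single i 1 : Site 4) j) := by
              intro h; have := h i hi; simp at this; have := hwb.1 i; omega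
            have hB : ¬ (∀ j : Fin 4, j ≠ 0 → (w - Pi.single i 1 : Site 4) j = z j) := by
              intro h
              refine key w 1 le_rfl (by omega) (fun j hj => ?_) hf (by omega)
              have := h j hj
              by_cases hji : j = i
              · subst hji; simp at this ⊢; omega
              · simp [hji] at this ⊢; omega
            have hC : (∀ j : Fin 4, j ≠ 0 → w j = z j) ↔ (∀ j : Fin 4, j ≠ 0 → (w - Pi.single i 1 : Site 4) j = (z - Pi.single i 1 : Site 4) j) := by
              refine ⟨fun h j hj => by simp [Pi.sub_apply, h j hj], fun h j hj => by have := h j hj; simpa [Pi.sub_apply] using this⟩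
            constructor
            · rintro (h | h)
              · exact Or.inr (hC.1 h)
              · exact absurd h hA
            · rintro (h | h)
              · exact absurd h hB
              · exact Or.inl (hC.2 h)
          · intro w hf hw0 hY
            simp only at hY ⊢
            rw [update_eq_update_iff, update_eq_update_iff] at hY
            have hwb := box_of_mem hf
            rcases hY with h | h
            · funext j; by_cases hj : j = 0
              · subst hj; exact hw0
              · exact h j hj
            · exfalso; have := h i hi; simp at this; have := hwb.1 i; omega
        · by_cases hzi1 : z i = 2 * (H : ℤ) - 1
          · -- column doubled through the face `x_i = 2H`: `y₂ = z + e_i`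
            refine (inv_diag_le_of_column _ i hi rfl (z 0) rfl ht1 (z + Pi.single i 1) ?_ ?_ ?_).trans b2
            · intro j hj
              have := hbox.1 j
              by_cases hji : j = i
              · subst hji; simp; omega
              · simp [hji]; omega
            · intro w hf hw0
              simp only
              have hwb := box_of_mem hf
              rw [update_eq_update_iff, update_eq_update_iff, update_eq_update_iff, update_eq_update_iff]
              have hA : ¬ (∀ j : Fin 4, j ≠ 0 → w j = z j) := by
                intro h
                refine key w (z i) (by omega) (by omega) (fun j hj => ?_) hf (by omega)
                by_cases hji : j = i
                · subst hji; simp [h j hj]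
                · rw [if_neg hji]; exact h j hj
              have hB : ¬ (∀ j : Fin 4, j ≠ 0 → (w - Pi.single i 1 : Site 4) j = (z + Pi.single i 1 : Site 4) j) := by
                intro h; have := h i hi; simp at this; have := hwb.1 i; omega
              have hC : (∀ j : Fin 4, j ≠ 0 → w j = (z + Pi.single i 1 : Site 4) j) ↔
                  (∀ j : Fin 4, j ≠ 0 → (w - Pi.single i 1 : Site 4) j = z j) := by
                refine ⟨fun h j hj => ?_, fun h j hj => ?_⟩
                · have := h j hj
                  by_cases hji : j = i
                  · subst hji; simp at this ⊢; omega
                  · simp [hji] at this ⊢; omega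
                · have := h j hj
                  by_cases hji : j = i
                  · subst hji; simp at this ⊢; omega
                  · simp [hji] at this ⊢; omega
              constructor
              · rintro (h | h)
                · exact absurd h hA
                · exact Or.inl (hC.1 h)
              · rintro (h | h)
                · exact Or.inr (hC.2 h)
                · exact absurd h hB
            · intro w hf hw0 hY
              simp only at hY ⊢
              rw [update_eq_update_iff, update_eq_update_iff] at hY
              have hwb := box_of_mem hf
              rcases hY with h | h
              · funext j; by_cases hj : j = 0
                · subst hj; exact hw0
                · exact h j hj
              · exfalso; have := h i hi; simp at this; have := hwb.2; omega
          · -- single interior column: `y₂ = z`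
            refine (inv_diag_le_of_column _ i hi rfl (z 0) rfl ht1 z ?_ ?_ ?_).trans b2
            · intro j hj
              have := hbox.1 j
              by_cases hji : j = i
              · subst hji; simp; omega
              · simp [hji]; omega
            · intro w hf hw0
              simp only [or_self]
              rw [update_eq_update_iff, update_eq_update_iff]
              have hA : ¬ (∀ j : Fin 4, j ≠ 0 → w j = z j) := by
                intro h
                refine key w (z i) (by omega) (by omega) (fun j hj => ?_) hf (by omega)
                by_cases hji : j = i
                · subst hji; simp [h j hj]
                · rw [if_neg hji]; exact h j hj
              have hB : ¬ (∀ j : Fin 4, j ≠ 0 → (w - Pi.single i 1 : Site 4) j = z j) := by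
                intro h
                refine key w (z i + 1) (by omega) (by omega) (fun j hj => ?_) hf (by omega)
                have := h j hj
                by_cases hji : j = i
                · subst hji; simp at this ⊢; omega
                · simp [hji] at this ⊢; omega
              exact iff_of_false hA hB
            · intro w _ hw0 hY
              simp only [or_self] at hY ⊢
              rw [update_eq_update_iff] at hY
              funext j; by_cases hj : j = 0
              · subst hj; exact hw0
              · exact hY j hj

/-! ## 7. The registered stub -/

/-- The registered stub statement `DirFreeVarLinear` of LINE-17 (skeleton v3, sha16 4747b363) on
`AllWindowsColdBox.BoxMidWindowsSU22` (stmt-QuantumFields-24003), verbatim; registered-stub copy, not a citable fact. -/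
abbrev DirFreeVarLinear : Prop :=
  ∃ c : ℝ, 0 < c ∧ ∀ H : ℕ, 1 ≤ H → ∀ e : DirFree H,
    ∫ s, (WithLp.ofLp s e) ^ 2 ∂(boxDirichlet H) ≤ c * H

/-- **STUB C of LINE-17 «hypercontractive second-order tilt expansion» (stmt-QuantumFields-24003), by name and signature:**
the perimeter law of the free forest-gauge field — every free Dirichlet edge variable has variance `≤ 16·H` (Thomson's principle
with explicit 2-chains: collar plaquettes, temporal columns, and the time-constant Pólya octant flow for the bottom «Polyakov»
edges). -/
theorem stub_dirFreeVarLinear : DirFreeVarLinear := by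
  refine ⟨16, by norm_num, fun H hH e => ?_⟩
  rw [integral_eval_sq_boxDirichlet]
  exact inv_diag_le hH e

end Assembly

end Summit.QuantumFields.YangMills.Theorems.AllWindowsColdBoxDirFreeVar

end
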